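import Summits.Ventures.HodgeRepro2.WeightThreeForm
import Summits.Ventures.HodgeRepro2.NeatCorollaries
import Summits.Ventures.HodgeRepro2.PeterssonCompactQuotient

/-!
# The non-vanishing input has positive Petersson norm

Kernel support for the blind cell pub-hodge-repro2 (seat p2): the gen-0 hypothesis shape
`NonVanishingInput` of `Hypothesis.lean` (two closed holomorphic `Γ`-invariant 1-forms `q₁, q₂` on `𝔹²`
with `q₁ ∧ q₂ ≢ 0`, `Γ` of finite index in `Γ₁`) produces, by row 82 (`WeightThreeForm.lean`), a
non-zero holomorphic weight-3 form `f = q₁ ∧ q₂` for `Γ`.  Passing to the torsion-free subgroup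
`S' := Γ ⊓ Γ_N` (`N > 2`), `f` is a weight-3 form for `S'`, and — if `S'\𝔹²` is compact — its Petersson
norm over a fundamental domain is POSITIVE (row 104).  So the period input of the transfer is a form of
positive Petersson norm: the `L²`-pairing behind (N) is non-degenerate on it.
-/

namespace Summit.Ventures.HodgeRepro2.ShimuraData

open MeasureTheory

section Helpers

variable {K : Type*} [Field K] {τ₁ : K →+* ℂ} {Q : Matrix (Fin 3) (Fin 3) ℂ}

/-- An automorphic form for the image of `Γ` (row 82) is a weight-`k` function for every subgroup
`S` with `↑S ⊆ Γ`. -/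
theorem IsAutomorphicForm.isWeightFor {Γ : Set (GL (Fin 3) K)} {k : ℕ} {f : (Fin 2 → ℂ) → ℂ}
    (hf : IsAutomorphicForm (realEmbedding K τ₁ Q '' Γ) k f) {S : Subgroup (GL (Fin 3) K)}
    (hS : (S : Set (GL (Fin 3) K)) ⊆ Γ) : IsWeightFor τ₁ Q S k f :=
  fun γ hγ z hz => hf.2 (realEmbedding K τ₁ Q γ) ⟨γ, hS hγ, rfl⟩ z hz

end Helpers

variable {K : Type*} [Field K] [NumberField K] [NumberField.IsCMField K]
    {τ₁ : K →+* ℂ} {H : Matrix (Fin 3) (Fin 3) K} {Q : Matrix (Fin 3) (Fin 3) ℂ}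
    {𝔪 : Submodule ℤ (Fin 3 → K)}

/-- **The non-vanishing input has positive Petersson norm.** Under `NonVanishingInput`, for every
`N > 2` there are a subgroup `S' ⊆ Γ_N` (torsion-free), a holomorphic weight-3 form `f` for `S'` with
`f z₀ ≠ 0`, and — provided the congruence quotients `S'\𝔹²` are compact (anisotropy) — a fundamental
domain `D` with `∫_D |f|² (1 − ‖z‖²)^3 dμ_B > 0`. -/
theorem NonVanishingInput.exists_setIntegral_petersson_pos (hH : IsHermitianForm K H)
    (hdef : ∀ τ : K →+* ℂ, NumberField.InfinitePlace.mk τ ≠ NumberField.InfinitePlace.mk τ₁ →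
      IsDefiniteAt K τ H)
    (hQ : IsFrame K τ₁ H Q) (h𝔪 : IsLattice K 𝔪) (h : NonVanishingInput K τ₁ H 𝔪 Q) {N : ℕ}
    (hN : 2 < N)
    (hcpt : ∀ S' : Subgroup (GL (Fin 3) K), (hS' : (S' : Set (GL (Fin 3) K)) ⊆ shimuraLevel K H 𝔪 N) →
      CompactSpace (ballQuotient hQ S' (subset_unitaryGroup_of_subset_shimuraLevel hS'))) :
    ∃ S' : Subgroup (GL (Fin 3) K), ∃ hS' : (S' : Set (GL (Fin 3) K)) ⊆ shimuraLevel K H 𝔪 N,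
      IsTorsionFreeSet K (S' : Set (GL (Fin 3) K)) ∧
      ∃ f : (Fin 2 → ℂ) → ℂ, IsWeightFor τ₁ Q S' 3 f ∧ DifferentiableOn ℂ f ball₂ ∧
        (∃ z₀ ∈ ball₂, f z₀ ≠ 0) ∧
        ∃ D : Set ball₂, IsBallFundamentalDomain hQ S' (subset_unitaryGroup_of_subset_shimuraLevel hS') D ∧
          0 < ∫ z in D, petersson 3 f (z : Fin 2 → ℂ) ∂bergmanBall := by
  obtain ⟨Γ, ⟨S, T, hSΓ, -, -, -⟩, f, hf, z₀, hz₀, hne⟩ :=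
    NonVanishingInput.exists_isAutomorphicForm_ne_zero hQ h
  let S' : Subgroup (GL (Fin 3) K) := S ⊓ shimuraLevelSubgroup K H 𝔪 N
  have hS' : (S' : Set (GL (Fin 3) K)) ⊆ shimuraLevel K H 𝔪 N := by
    intro γ hγ
    rw [← coe_shimuraLevelSubgroup]
    exact hγ.2
  have hS'S : (S' : Set (GL (Fin 3) K)) ⊆ Γ := by
    intro γ hγ
    rw [← hSΓ]
    exact hγ.1
  have htf : IsTorsionFreeSet K (S' : Set (GL (Fin 3) K)) :=
    (isTorsionFreeSet_shimuraLevel τ₁ H h𝔪 hN).mono hS'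
  have hfw : IsWeightFor τ₁ Q S' 3 f := hf.isWeightFor hS'S
  haveI := hcpt S' hS'
  obtain ⟨D, hD, hpos⟩ := exists_fundamentalDomain_setIntegral_petersson_pos hH hdef hQ h𝔪 hS' htf
    hfw hf.1.continuousOn hz₀ hne
  exact ⟨S', hS', htf, f, hfw, hf.1, ⟨z₀, hz₀, hne⟩, D, hD, hpos⟩

end Summit.Ventures.HodgeRepro2.ShimuraData
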